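import Summits.HodgeConjecture.HodgeCM.Proofs.LandherrHermitian_1

/-! PORT of `HodgeCM/Proofs/LandherrHermitian.lean` (HodgeCMPerL run 82) — part 2: continuation of `Summits.HodgeConjecture.HodgeCM.Proofs.LandherrHermitian_1` (split at a top-level declaration boundary by port_pkg.py; scope re-opened below; declarations unchanged). -/

-- port_pkg: scope re-opened for this part (file-level context, then the namespace/section stack open at the cut)
noncomputable section
open NumberField
open scoped Matrix ComplexOrder
namespace HodgeCM
open Literature.AlgebraicGeometry.ShimuraVarieties (conjRingHomK embedding_conjRingHomK)
namespace LandherrHermitian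
variable (L : CMField)
/-- **Converse (necessity of the invariants), arbitrary Gram matrices.** Congruent hermitian planes have
the same typed signature at every complex embedding and the same discriminant class. -/
theorem landherr_planes_converse (H H' : Matrix (Fin 2) (Fin 2) L)
    (hiso : ∃ g : GL (Fin 2) L,
      ((g : Matrix (Fin 2) (Fin 2) L).transpose.map (conjRingHomK L)) * H *
        (g : Matrix (Fin 2) (Fin 2) L) = H') :
    (∀ τ : L →+* ℂ,
      ((H.map τ).PosDef ↔ (H'.map τ).PosDef) ∧ ((-H.map τ).PosDef ↔ (-H'.map τ).PosDef)) ∧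
    ∃ z : L, z ≠ 0 ∧ H.det = H'.det * (z * conjRingHomK L z) := by
  obtain ⟨g, rfl⟩ := hiso
  refine ⟨fun τ => ⟨(posDef_congr_iff L τ g H).symm, (negDef_congr_iff L τ g H).symm⟩, ?_⟩
  have hg0 : (g : Matrix (Fin 2) (Fin 2) L).det ≠ 0 := (Matrix.isUnits_det_units g).ne_zero
  have hg0c : conjRingHomK L (g : Matrix (Fin 2) (Fin 2) L).det ≠ 0 := (map_ne_zero _).mpr hg0
  refine ⟨((g : Matrix (Fin 2) (Fin 2) L).det)⁻¹, inv_ne_zero hg0, ?_⟩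
  change H.det = (cT L _ * H * _).det * _
  rw [det_congr, map_inv₀]
  field_simp

/-- **Landherr's theorem for hermitian planes over a CM field** [La36] (`n = 2` of Shimura 2008 Thm. 2.2;
Rogawski 1990 §1.9), arbitrary Gram matrices: two non-degenerate `σ`-hermitian planes over `L` are
isometric iff they have the same signature at every complex embedding of `L` and the same discriminant in
`L₀^× / N_{L/L₀}(L^×)`.  Unconditional (closure: the standard trio). -/
theorem landherr_planes_iff (H H' : Matrix (Fin 2) (Fin 2) L)
    (hH : H.transpose.map (conjRingHomK L) = H) (hH' : H'.transpose.map (conjRingHomK L) = H')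
    (hdet : H.det ≠ 0) (hdet' : H'.det ≠ 0) :
    (∃ g : GL (Fin 2) L,
      ((g : Matrix (Fin 2) (Fin 2) L).transpose.map (conjRingHomK L)) * H *
        (g : Matrix (Fin 2) (Fin 2) L) = H') ↔
    ((∀ τ : L →+* ℂ,
      ((H.map τ).PosDef ↔ (H'.map τ).PosDef) ∧ ((-H.map τ).PosDef ↔ (-H'.map τ).PosDef)) ∧
    ∃ z : L, z ≠ 0 ∧ H.det = H'.det * (z * conjRingHomK L z)) :=
  ⟨landherr_planes_converse L H H', fun h => landherr_planes L H H' hH hH' hdet hdet' h.1 h.2⟩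

end LandherrHermitian

/-- Root alias: **Landherr's classification of hermitian planes over a CM field, arbitrary Gram matrices**
(`HodgeCM.LandherrHermitian.landherr_planes_iff`). -/
theorem landherr_planes_iff (L : CMField) (H H' : Matrix (Fin 2) (Fin 2) L)
    (hH : H.transpose.map (conjRingHomK L) = H) (hH' : H'.transpose.map (conjRingHomK L) = H')
    (hdet : H.det ≠ 0) (hdet' : H'.det ≠ 0) :
    (∃ g : GL (Fin 2) L,
      ((g : Matrix (Fin 2) (Fin 2) L).transpose.map (conjRingHomK L)) * H *
        (g : Matrix (Fin 2) (Fin 2) L) = H') ↔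
    ((∀ τ : L →+* ℂ,
      ((H.map τ).PosDef ↔ (H'.map τ).PosDef) ∧ ((-H.map τ).PosDef ↔ (-H'.map τ).PosDef)) ∧
    ∃ z : L, z ≠ 0 ∧ H.det = H'.det * (z * conjRingHomK L z)) :=
  LandherrHermitian.landherr_planes_iff L H H' hH hH' hdet hdet'

end HodgeCM

end
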